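import Summits.AtomisticToContinuum.FouriersLaw.Theorems.BondHeatUncertaintyExtensiveSnapshotIrreversibilityEnergyWindowSkeletonSurjectivity

/-!
# Energy window, part W-1 — pointwise calculus of the skeleton control fields: implicit
differentiation of `(Γ+κ)⁻¹e`, the derivative of the Gram matrix, and the size of `u_j`, `∂_j u_j`

Lineage `stmt-AtomisticToContinuum-9121` (`ExtensiveSnapshotIrreversibility`), K_fix half, leaf S3
`KernelTemperatureLipschitz`; cell decomp-a2c, lens «grading / quantitative ladder», generation 81,
part W «Glues», file 1.  PURPOSE: the four `L¹(wienerPair)` conditions of the arrival / departure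
identities (part T-b `integral_mul_skelWeightArr_eq` / `…Dep_eq`: the products `G u_j`, `x_j G u_j`,
`∂_jG u_j`, `G ∂_j u_j`) are discharged in file 2 from POINTWISE bounds on the fields proved here,
for a GENERIC coordinate field `e(x)` (arrival: `e ≡ e_{p_b}`; departure: `e = V(x)`, the
departure vector): with `c = (Γ+κ)⁻¹ e` (`skelCtrlGen`) and `u = Jᵀc` (`skelFieldGen`; R's
`skelFieldArr` / `skelFieldDep` are the two instances, by `rfl`),
* §1 the coordinate functionals `coordCLM a` (`v ↦ coordV v a`) and `∂(coordV ∘ f) = coordV ∘ ∂f`;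
* §2 `|((Γ+κ)⁻¹ v)_i| ≤ κ⁻¹ Σ_a |v_a|` (part S `sq_defect_le` + `mul_dotProduct_regInv_mulVec_le`),
  `|J_ij| ≤ ‖D E(x) b_j‖`, hence ★ `|u_j| ≤ (2N) κ⁻¹ |e|₁ ‖D E(x) b_j‖` (`abs_skelFieldGen_le`);
* §3 derivatives along a skeleton direction `v`: `∂J_ij = coordV(∂_v(D E b_j))_i`,
  `∂Γ_ki = 2^{-m} Σ_l (J_kl ∂J_il + J_il ∂J_kl)` with `|∂Γ_ki| ≤ 2·2^{-m} Σ_l ‖DE b_l‖ ‖∂_v DE b_l‖`,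
  and IMPLICIT DIFFERENTIATION of `(Γ+κ) c = e`: `∂c = (Γ+κ)⁻¹(∂e − (∂Γ) c)`
  (`fderiv_skelCtrlGen_eq`), whence `|∂c_i| ≤ κ⁻¹ (|∂e|₁ + κ⁻¹ |e|₁ Σ_{k,i} |∂Γ_ki|)`;
* §4 ★ `|∂_v u_j| ≤ (2N)(κ⁻¹|e|₁ ‖∂_v DE b_j‖ + ‖DE b_j‖ κ⁻¹ (|∂e|₁ + κ⁻¹|e|₁ (2N)² 2 Θ_v))`,
  `Θ_v = 2^{-m} Σ_l ‖DE b_l‖ ‖∂_v DE b_l‖` (`abs_fderiv_skelFieldGen_le`).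
Only first / second skeleton variations of the flow and `e`, `∂e` enter — exactly what (JMˣ)₁, (JMˣ)₂
(and, for the departure, (JM) and the mixed variation) control in the mean.  Constants are crude
(dimension factors `2N = card (Fin N ⊕ Fin N)`): file 2 needs finiteness at FIXED `m`, `κ`, not
uniformity.  No instance / notation / option; no proof holes.
References: D. Nualart, The Malliavin Calculus and Related Topics (2006), Prop. 1.3.1, Lemma 2.1.6
[cite: Nualart2006, Prop 1.3.1]; R. Horn, C. Johnson, Matrix Analysis (2013), §0.7 (derivative of
the inverse) [cite: HornJohnson2013, §0.7]. [folklore]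

**File 1 of 2** (split for the 400-line cap): this file holds §§1–3 (coordinate functionals, the generic control field, derivatives along a skeleton direction); the sequel module `…BondHeatUncertaintyExtensiveSnapshotIrreversibilityEnergyWindowSkeletonFieldCalculus` continues in the same namespace (all declaration names unchanged).
-/

noncomputable section

namespace Summit.AtomisticToContinuum.FouriersLaw.Theorems.ExtensiveSnapshotIrreversibility.EnergyWindow

open MeasureTheory ProbabilityTheory Filter Topology Set
open scoped ENNReal NNReal Matrix ContDiff
open Literature.MathematicalPhysics.KineticTheory.HeatConduction
open Literature.Probability.Process

/-! ## 1. Coordinate functionals -/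

/-- The coordinate functional `v ↦ coordV v a` as a continuous linear map. [folklore] -/
def coordCLM (N : ℕ) (a : Fin N ⊕ Fin N) : PhaseSpace N →L[ℝ] ℝ :=
  Sum.elim
    (fun i => (ContinuousLinearMap.proj i).comp (ContinuousLinearMap.fst ℝ (Fin N → ℝ) (Fin N → ℝ)))
    (fun i => (ContinuousLinearMap.proj i).comp (ContinuousLinearMap.snd ℝ (Fin N → ℝ) (Fin N → ℝ)))
    a

/-- `coordCLM a v = coordV v a`. [folklore] -/
@[simp] theorem coordCLM_apply {N : ℕ} (a : Fin N ⊕ Fin N) (v : PhaseSpace N) :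
    coordCLM N a v = coordV N v a := by
  rcases a with i | i <;> rfl

/-- `∂_v (coordV (f ·) a) = coordV (∂_v f) a`. [folklore] -/
theorem fderiv_coordV_comp {N : ℕ} {X : Type} [NormedAddCommGroup X] [NormedSpace ℝ X]
    {f : X → PhaseSpace N} {x : X} (hf : DifferentiableAt ℝ f x) (a : Fin N ⊕ Fin N) (v : X) :
    fderiv ℝ (fun y => coordV N (f y) a) x v = coordV N (fderiv ℝ f x v) a := by
  have h : (fun y => coordV N (f y) a) = (coordCLM N a) ∘ f := by
    funext y; rw [Function.comp_apply, coordCLM_apply]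
  rw [h, ((coordCLM N a).hasFDerivAt.comp x hf.hasFDerivAt).fderiv, ContinuousLinearMap.comp_apply,
    coordCLM_apply]

/-- `Σ_a |momCoord b a| = 1`. [folklore] -/
theorem sum_abs_momCoord (N : ℕ) (b : Fin N) : ∑ a, |momCoord N b a| = 1 := by
  classical
  rw [Finset.sum_eq_single (Sum.inr b) (fun a _ ha => by simp [momCoord, ha])
    (fun h => absurd (Finset.mem_univ _) h)]
  simp [momCoord]

/-! ## 2. The generic control field and its size -/

section Objects

variable (ω₂ lam β γ : ℝ) (N : ℕ) (T_L T_R : ℝ) (s : ℝ) (m : ℕ)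

/-- The **generic control** `c = (Γ+κ)⁻¹ e(x)` for a coordinate field `e` on skeleton space.
[folklore] -/
def skelCtrlGen (κ : ℝ) (z : PhaseSpace N) (r : WienerPair)
    (e : PairSkeleton m → Fin N ⊕ Fin N → ℝ) (x : PairSkeleton m) : Fin N ⊕ Fin N → ℝ :=
  regInv (skelGramAt ω₂ lam β γ N T_L T_R s m z r x) κ *ᵥ e x

/-- The **generic field** `u = Jᵀ c = c J` on skeleton space. [folklore] -/
def skelFieldGen (κ : ℝ) (z : PhaseSpace N) (r : WienerPair)
    (e : PairSkeleton m → Fin N ⊕ Fin N → ℝ) (x : PairSkeleton m) :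
    Fin (2 ^ m) ⊕ Fin (2 ^ m) → ℝ :=
  skelCtrlGen ω₂ lam β γ N T_L T_R s m κ z r e x ᵥ* skelJacAt ω₂ lam β γ N T_L T_R s m z r x

/-- R's arrival control is the generic control of the constant field `e_{p_b}`. [folklore] -/
theorem skelCtrlArr_eq_skelCtrlGen (κ : ℝ) (b : Fin N) (z : PhaseSpace N) (r : WienerPair)
    (x : PairSkeleton m) : skelCtrlArr ω₂ lam β γ N T_L T_R s m κ b z r x =
      skelCtrlGen ω₂ lam β γ N T_L T_R s m κ z r (fun _ => momCoord N b) x := rfl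

/-- R's arrival field is the generic field of the constant field `e_{p_b}`. [folklore] -/
theorem skelFieldArr_eq_skelFieldGen (κ : ℝ) (b : Fin N) (z : PhaseSpace N) (r : WienerPair)
    (x : PairSkeleton m) : skelFieldArr ω₂ lam β γ N T_L T_R s m κ b z r x =
      skelFieldGen ω₂ lam β γ N T_L T_R s m κ z r (fun _ => momCoord N b) x := rfl

/-- R's departure control is the generic control of the departure vector field. [folklore] -/
theorem skelCtrlDep_eq_skelCtrlGen (κ : ℝ) (b : Fin N) (z : PhaseSpace N) (r : WienerPair)
    (x : PairSkeleton m) : skelCtrlDep ω₂ lam β γ N T_L T_R s m κ b z r x =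
      skelCtrlGen ω₂ lam β γ N T_L T_R s m κ z r (skelDepVec ω₂ lam β γ N T_L T_R s m b z r) x :=
  rfl

/-- R's departure field is the generic field of the departure vector field. [folklore] -/
theorem skelFieldDep_eq_skelFieldGen (κ : ℝ) (b : Fin N) (z : PhaseSpace N) (r : WienerPair)
    (x : PairSkeleton m) : skelFieldDep ω₂ lam β γ N T_L T_R s m κ b z r x =
      skelFieldGen ω₂ lam β γ N T_L T_R s m κ z r (skelDepVec ω₂ lam β γ N T_L T_R s m b z r) x :=
  rfl

/-- The Jacobian entries are coordinates of the skeleton variations. [folklore] -/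
theorem skelJacAt_apply (z : PhaseSpace N) (r : WienerPair) (x : PairSkeleton m)
    (i : Fin N ⊕ Fin N) (j : Fin (2 ^ m) ⊕ Fin (2 ^ m)) :
    skelJacAt ω₂ lam β γ N T_L T_R s m z r x i j =
      coordV N (fderiv ℝ (skelFlowMapAt ω₂ lam β γ N T_L T_R s m z r) x (basisX m j)) i := rfl

end Objects

/-- ★ `|((Γ+κ)⁻¹ v)_i| ≤ κ⁻¹ Σ_a |v_a|` for `Γ ⪰ 0`, `κ > 0`. [folklore] -/
theorem abs_regInv_mulVec_apply_le {ι : Type} [Fintype ι] [DecidableEq ι] {Γ : Matrix ι ι ℝ}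
    (hΓ : Γ.PosSemidef) {κ : ℝ} (hκ : 0 < κ) (v : ι → ℝ) (i : ι) :
    |(regInv Γ κ *ᵥ v) i| ≤ κ⁻¹ * ∑ a, |v a| := by
  set c := regInv Γ κ *ᵥ v with hc
  have h1 : κ ^ 2 * (c ⬝ᵥ c) ≤ v ⬝ᵥ v :=
    (sq_defect_le hΓ hκ v).trans (mul_dotProduct_regInv_mulVec_le hΓ hκ v)
  have h2 : κ * √(c ⬝ᵥ c) ≤ √(v ⬝ᵥ v) := by
    have h : κ * √(c ⬝ᵥ c) = √(κ ^ 2 * (c ⬝ᵥ c)) := by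
      rw [Real.sqrt_mul' _ (dotProduct_self_nonneg_real c), Real.sqrt_sq hκ.le]
    rw [h]
    exact Real.sqrt_le_sqrt h1
  calc |c i| ≤ √(c ⬝ᵥ c) := abs_apply_le_sqrt_dotProduct c i
    _ = κ⁻¹ * (κ * √(c ⬝ᵥ c)) := by rw [← mul_assoc, inv_mul_cancel₀ hκ.ne', one_mul]
    _ ≤ κ⁻¹ * ∑ a, |v a| :=
        mul_le_mul_of_nonneg_left (h2.trans (sqrt_dotProduct_le_sum_abs v)) (inv_nonneg.2 hκ.le)

section Pointwise

variable {ω₂ lam β γ : ℝ} (hω : 0 < ω₂) (hl : 0 ≤ lam) (hβ : 0 ≤ β) (hγ : 0 ≤ γ) (N : ℕ)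
  (T_L T_R : ℝ)

/-- `|J_ij| ≤ ‖D E(x) b_j‖`. [folklore] -/
theorem abs_skelJacAt_le (s : ℝ) (m : ℕ) (z : PhaseSpace N) (r : WienerPair) (x : PairSkeleton m)
    (i : Fin N ⊕ Fin N) (j : Fin (2 ^ m) ⊕ Fin (2 ^ m)) :
    |skelJacAt ω₂ lam β γ N T_L T_R s m z r x i j| ≤
      ‖fderiv ℝ (skelFlowMapAt ω₂ lam β γ N T_L T_R s m z r) x (basisX m j)‖ := by
  rw [skelJacAt_apply]
  exact abs_coordV_apply_le_norm _ _

/-- `|c_i| ≤ κ⁻¹ |e(x)|₁` for the generic control. [folklore] -/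
theorem abs_skelCtrlGen_le (s : ℝ) (m : ℕ) {κ : ℝ} (hκ : 0 < κ) (z : PhaseSpace N)
    (r : WienerPair) (e : PairSkeleton m → Fin N ⊕ Fin N → ℝ) (x : PairSkeleton m)
    (i : Fin N ⊕ Fin N) :
    |skelCtrlGen ω₂ lam β γ N T_L T_R s m κ z r e x i| ≤ κ⁻¹ * ∑ a, |e x a| :=
  abs_regInv_mulVec_apply_le (posSemidef_skelGramAt z r x) hκ (e x) i

/-- ★ **Size of the field**: `|u_j(x)| ≤ (2N) · κ⁻¹|e(x)|₁ · ‖D E(x) b_j‖`. [folklore] -/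
theorem abs_skelFieldGen_le (s : ℝ) (m : ℕ) {κ : ℝ} (hκ : 0 < κ) (z : PhaseSpace N)
    (r : WienerPair) (e : PairSkeleton m → Fin N ⊕ Fin N → ℝ) (x : PairSkeleton m)
    (j : Fin (2 ^ m) ⊕ Fin (2 ^ m)) :
    |skelFieldGen ω₂ lam β γ N T_L T_R s m κ z r e x j| ≤
      (Fintype.card (Fin N ⊕ Fin N) : ℝ) * (κ⁻¹ * ∑ a, |e x a|) *
        ‖fderiv ℝ (skelFlowMapAt ω₂ lam β γ N T_L T_R s m z r) x (basisX m j)‖ := by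
  unfold skelFieldGen
  simp only [Matrix.vecMul, dotProduct]
  refine (Finset.abs_sum_le_sum_abs _ _).trans ?_
  calc ∑ i, |skelCtrlGen ω₂ lam β γ N T_L T_R s m κ z r e x i *
          skelJacAt ω₂ lam β γ N T_L T_R s m z r x i j|
      ≤ ∑ _i : Fin N ⊕ Fin N, (κ⁻¹ * ∑ a, |e x a|) *
          ‖fderiv ℝ (skelFlowMapAt ω₂ lam β γ N T_L T_R s m z r) x (basisX m j)‖ :=
        Finset.sum_le_sum fun i _ => by
          rw [abs_mul]
          exact mul_le_mul (abs_skelCtrlGen_le N T_L T_R s m hκ z r e x i)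
            (abs_skelJacAt_le N T_L T_R s m z r x i j) (abs_nonneg _) (by positivity)
    _ = _ := by rw [Finset.sum_const, Finset.card_univ, nsmul_eq_mul]; ring

/-! ## 3. Derivatives along a skeleton direction -/

include hω hl hβ hγ

/-- `y ↦ D E(y) δ` is differentiable (the flow map is `C^∞` in the skeleton). [folklore] -/
theorem differentiable_fderiv_skelFlowMapAt_apply {s : ℝ} (hs : s ∈ Icc (0 : ℝ) 1) (m : ℕ)
    (z : PhaseSpace N) (r : WienerPair) (δ : PairSkeleton m) :
    Differentiable ℝ fun y => fderiv ℝ (skelFlowMapAt ω₂ lam β γ N T_L T_R s m z r) y δ := by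
  have h : ContDiff ℝ ∞ fun y => fderiv ℝ (skelFlowMapAt ω₂ lam β γ N T_L T_R s m z r) y δ :=
    ((contDiff_skelFlowMapAt hω hl hβ hγ N T_L T_R hs m z r).fderiv_right (by simp)).clm_apply
      contDiff_const
  exact h.differentiable (by simp)

/-- `∂_v J_ij = coordV(∂_v (D E b_j))_i`. [folklore] -/
theorem fderiv_skelJacAt_apply {s : ℝ} (hs : s ∈ Icc (0 : ℝ) 1) (m : ℕ) (z : PhaseSpace N)
    (r : WienerPair) (x : PairSkeleton m) (i : Fin N ⊕ Fin N) (j : Fin (2 ^ m) ⊕ Fin (2 ^ m))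
    (v : PairSkeleton m) :
    fderiv ℝ (fun y => skelJacAt ω₂ lam β γ N T_L T_R s m z r y i j) x v =
      coordV N (fderiv ℝ (fun y => fderiv ℝ (skelFlowMapAt ω₂ lam β γ N T_L T_R s m z r) y
        (basisX m j)) x v) i := by
  simp only [skelJacAt_apply]
  exact fderiv_coordV_comp
    ((differentiable_fderiv_skelFlowMapAt_apply hω hl hβ hγ N T_L T_R hs m z r (basisX m j)) x) i v

/-- `|∂_v J_ij| ≤ ‖∂_v (D E b_j)‖`. [folklore] -/
theorem abs_fderiv_skelJacAt_apply_le {s : ℝ} (hs : s ∈ Icc (0 : ℝ) 1) (m : ℕ) (z : PhaseSpace N)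
    (r : WienerPair) (x : PairSkeleton m) (i : Fin N ⊕ Fin N) (j : Fin (2 ^ m) ⊕ Fin (2 ^ m))
    (v : PairSkeleton m) :
    |fderiv ℝ (fun y => skelJacAt ω₂ lam β γ N T_L T_R s m z r y i j) x v| ≤
      ‖fderiv ℝ (fun y => fderiv ℝ (skelFlowMapAt ω₂ lam β γ N T_L T_R s m z r) y
        (basisX m j)) x v‖ := by
  rw [fderiv_skelJacAt_apply hω hl hβ hγ N T_L T_R hs]
  exact abs_coordV_apply_le_norm _ _

/-- **The derivative of the Gram entries**: `∂_v Γ_ki = 2^{-m} Σ_l (J_kl ∂_vJ_il + J_il ∂_vJ_kl)`.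
[folklore] -/
theorem fderiv_skelGramAt_apply {s : ℝ} (hs : s ∈ Icc (0 : ℝ) 1) (m : ℕ) (z : PhaseSpace N)
    (r : WienerPair) (x : PairSkeleton m) (k i : Fin N ⊕ Fin N) (v : PairSkeleton m) :
    fderiv ℝ (fun y => skelGramAt ω₂ lam β γ N T_L T_R s m z r y k i) x v =
      ((2 : ℝ) ^ m)⁻¹ * ∑ l, (skelJacAt ω₂ lam β γ N T_L T_R s m z r x k l *
          fderiv ℝ (fun y => skelJacAt ω₂ lam β γ N T_L T_R s m z r y i l) x v +
        skelJacAt ω₂ lam β γ N T_L T_R s m z r x i l *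
          fderiv ℝ (fun y => skelJacAt ω₂ lam β γ N T_L T_R s m z r y k l) x v) := by
  have hJ : ∀ a l, HasFDerivAt (fun y => skelJacAt ω₂ lam β γ N T_L T_R s m z r y a l)
      (fderiv ℝ (fun y => skelJacAt ω₂ lam β γ N T_L T_R s m z r y a l) x) x := fun a l =>
    ((contDiff_skelJacAt_apply hω hl hβ hγ N T_L T_R hs m z r a l).differentiable
      (by simp) x).hasFDerivAt
  have hsum : HasFDerivAt (fun y => ∑ l, skelJacAt ω₂ lam β γ N T_L T_R s m z r y k l *
      skelJacAt ω₂ lam β γ N T_L T_R s m z r y i l)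
      (∑ l, (skelJacAt ω₂ lam β γ N T_L T_R s m z r x k l •
          fderiv ℝ (fun y => skelJacAt ω₂ lam β γ N T_L T_R s m z r y i l) x +
        skelJacAt ω₂ lam β γ N T_L T_R s m z r x i l •
          fderiv ℝ (fun y => skelJacAt ω₂ lam β γ N T_L T_R s m z r y k l) x)) x :=
    HasFDerivAt.fun_sum fun l _ => (hJ k l).fun_mul (hJ i l)
  have hfun : (fun y => skelGramAt ω₂ lam β γ N T_L T_R s m z r y k i) = fun y =>
      ((2 : ℝ) ^ m)⁻¹ * ∑ l, skelJacAt ω₂ lam β γ N T_L T_R s m z r y k l *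
        skelJacAt ω₂ lam β γ N T_L T_R s m z r y i l := funext fun y => skelGramAt_apply N T_L T_R s m z r y k i
  rw [hfun, (hsum.const_mul (((2 : ℝ) ^ m)⁻¹)).fderiv]
  simp only [_root_.smul_apply, _root_.sum_apply, _root_.add_apply, smul_eq_mul]

/-- **Size of `∂_v Γ`**: `|∂_v Γ_ki| ≤ 2·2^{-m} Σ_l ‖DE b_l‖ ‖∂_v DE b_l‖`. [folklore] -/
theorem abs_fderiv_skelGramAt_apply_le {s : ℝ} (hs : s ∈ Icc (0 : ℝ) 1) (m : ℕ)
    (z : PhaseSpace N) (r : WienerPair) (x : PairSkeleton m) (k i : Fin N ⊕ Fin N)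
    (v : PairSkeleton m) :
    |fderiv ℝ (fun y => skelGramAt ω₂ lam β γ N T_L T_R s m z r y k i) x v| ≤
      2 * (((2 : ℝ) ^ m)⁻¹ * ∑ l, ‖fderiv ℝ (skelFlowMapAt ω₂ lam β γ N T_L T_R s m z r) x
          (basisX m l)‖ *
        ‖fderiv ℝ (fun y => fderiv ℝ (skelFlowMapAt ω₂ lam β γ N T_L T_R s m z r) y
          (basisX m l)) x v‖) := by
  rw [fderiv_skelGramAt_apply hω hl hβ hγ N T_L T_R hs, abs_mul, abs_of_pos (by positivity),
    mul_comm (2 : ℝ), mul_assoc, Finset.sum_mul]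
  refine mul_le_mul_of_nonneg_left ((Finset.abs_sum_le_sum_abs _ _).trans
    (Finset.sum_le_sum fun l _ => ?_)) (by positivity)
  refine (abs_add_le _ _).trans ?_
  rw [abs_mul, abs_mul, mul_two]
  exact add_le_add
    (mul_le_mul (abs_skelJacAt_le N T_L T_R s m z r x k l)
      (abs_fderiv_skelJacAt_apply_le hω hl hβ hγ N T_L T_R hs m z r x i l v) (abs_nonneg _)
      (norm_nonneg _))
    (mul_le_mul (abs_skelJacAt_le N T_L T_R s m z r x i l)
      (abs_fderiv_skelJacAt_apply_le hω hl hβ hγ N T_L T_R hs m z r x k l v) (abs_nonneg _)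
      (norm_nonneg _))

/-- **Implicit differentiation of `(Γ+κ) c = e`**: along any direction `v`,
`∂_v c = (Γ+κ)⁻¹ (∂_v e − (∂_v Γ) c)`, entrywise, for a differentiable field `e`. [folklore] -/
theorem fderiv_skelCtrlGen_eq {s : ℝ} (hs : s ∈ Icc (0 : ℝ) 1) (m : ℕ) {κ : ℝ} (hκ : 0 < κ)
    (z : PhaseSpace N) (r : WienerPair) {e : PairSkeleton m → Fin N ⊕ Fin N → ℝ}
    (he : ∀ a, Differentiable ℝ fun y => e y a) (x v : PairSkeleton m) :
    (fun i => fderiv ℝ (fun y => skelCtrlGen ω₂ lam β γ N T_L T_R s m κ z r e y i) x v) =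
      regInv (skelGramAt ω₂ lam β γ N T_L T_R s m z r x) κ *ᵥ
        ((fun k => fderiv ℝ (fun y => e y k) x v) -
          (fun k i => fderiv ℝ (fun y => skelGramAt ω₂ lam β γ N T_L T_R s m z r y k i) x v) *ᵥ
            skelCtrlGen ω₂ lam β γ N T_L T_R s m κ z r e x) := by
  -- differentiability of the entries
  have hR : ∀ k l, Differentiable ℝ fun y =>
      regInv (skelGramAt ω₂ lam β γ N T_L T_R s m z r y) κ k l := fun k l =>
    (contDiff_regInv_skelGramAt_apply hω hl hβ hγ N T_L T_R hs m hκ z r k l).differentiable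
      (by simp)
  have hΓd : ∀ k i, Differentiable ℝ fun y => skelGramAt ω₂ lam β γ N T_L T_R s m z r y k i :=
    fun k i => (contDiff_skelGramAt_apply hω hl hβ hγ N T_L T_R hs m z r k i).differentiable
      (by simp)
  have hcd : ∀ i, Differentiable ℝ fun y => skelCtrlGen ω₂ lam β γ N T_L T_R s m κ z r e y i :=
    fun i => by
    have h : (fun y => skelCtrlGen ω₂ lam β γ N T_L T_R s m κ z r e y i) = fun y =>
        ∑ l, regInv (skelGramAt ω₂ lam β γ N T_L T_R s m z r y) κ i l * e y l := by
      funext y; simp only [skelCtrlGen, Matrix.mulVec, dotProduct]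
    rw [h]
    exact Differentiable.fun_sum fun l _ => (hR i l).fun_mul (he l)
  -- the identity `(Γ+κ) c = e`, entrywise, as functions of `y`
  have hid : ∀ k, (fun y => e y k) = fun y =>
      ∑ i, (skelGramAt ω₂ lam β γ N T_L T_R s m z r y k i + κ * (1 : Matrix _ _ ℝ) k i) *
        skelCtrlGen ω₂ lam β γ N T_L T_R s m κ z r e y i := by
    intro k; funext y
    have h : (skelGramAt ω₂ lam β γ N T_L T_R s m z r y + κ • (1 : Matrix _ _ ℝ)) *ᵥ
        skelCtrlGen ω₂ lam β γ N T_L T_R s m κ z r e y = e y := by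
      simp only [skelCtrlGen, Matrix.mulVec_mulVec]
      rw [self_mul_regInv hκ z r y, Matrix.one_mulVec]
    have hk := congrFun h k
    simp only [Matrix.mulVec, dotProduct, Matrix.add_apply, Matrix.smul_apply, smul_eq_mul] at hk
    exact hk.symm
  -- differentiate the identity along `v`: `∂e_k = Σ_i ((Γ+κ)_ki ∂c_i + c_i ∂Γ_ki)`
  have hderiv : ∀ k, fderiv ℝ (fun y => e y k) x v =
      ∑ i, ((skelGramAt ω₂ lam β γ N T_L T_R s m z r x k i + κ * (1 : Matrix _ _ ℝ) k i) *
          fderiv ℝ (fun y => skelCtrlGen ω₂ lam β γ N T_L T_R s m κ z r e y i) x v +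
        skelCtrlGen ω₂ lam β γ N T_L T_R s m κ z r e x i *
          fderiv ℝ (fun y => skelGramAt ω₂ lam β γ N T_L T_R s m z r y k i) x v) := by
    intro k
    have h1 : ∀ i, HasFDerivAt
        (fun y => skelGramAt ω₂ lam β γ N T_L T_R s m z r y k i + κ * (1 : Matrix _ _ ℝ) k i)
        (fderiv ℝ (fun y => skelGramAt ω₂ lam β γ N T_L T_R s m z r y k i) x) x := fun i =>
      ((hΓd k i x).hasFDerivAt).add_const _
    have h2 : ∀ i, HasFDerivAt (fun y => skelCtrlGen ω₂ lam β γ N T_L T_R s m κ z r e y i)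
        (fderiv ℝ (fun y => skelCtrlGen ω₂ lam β γ N T_L T_R s m κ z r e y i) x) x := fun i =>
      (hcd i x).hasFDerivAt
    have hs' := HasFDerivAt.fun_sum (u := Finset.univ) fun i _ => (h1 i).fun_mul (h2 i)
    rw [hid k, hs'.fderiv]
    simp only [_root_.sum_apply, _root_.add_apply, _root_.smul_apply, smul_eq_mul]
  -- in matrix form `∂e - (∂Γ) c = (Γ+κ) ∂c`, then solve with `(Γ+κ)⁻¹ (Γ+κ) = 1`
  have hvec : (fun k => fderiv ℝ (fun y => e y k) x v) -
      (fun k i => fderiv ℝ (fun y => skelGramAt ω₂ lam β γ N T_L T_R s m z r y k i) x v) *ᵥ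
        skelCtrlGen ω₂ lam β γ N T_L T_R s m κ z r e x =
      (skelGramAt ω₂ lam β γ N T_L T_R s m z r x + κ • (1 : Matrix _ _ ℝ)) *ᵥ
        fun i => fderiv ℝ (fun y => skelCtrlGen ω₂ lam β γ N T_L T_R s m κ z r e y i) x v := by
    funext k
    rw [Pi.sub_apply, hderiv k, sub_eq_iff_eq_add]
    simp only [Matrix.mulVec, dotProduct, Matrix.add_apply, Matrix.smul_apply, smul_eq_mul,
      ← Finset.sum_add_distrib]
    exact Finset.sum_congr rfl fun i _ => by ring
  rw [hvec, Matrix.mulVec_mulVec, regInv_mul_self hκ z r x, Matrix.one_mulVec]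

/-- **Size of `∂_v c`**: `|∂_v c_i| ≤ κ⁻¹ (Σ_k |∂_v e_k| + κ⁻¹ |e|₁ Σ_k Σ_i |∂_v Γ_ki|)`. [folklore] -/
theorem abs_fderiv_skelCtrlGen_le {s : ℝ} (hs : s ∈ Icc (0 : ℝ) 1) (m : ℕ) {κ : ℝ} (hκ : 0 < κ)
    (z : PhaseSpace N) (r : WienerPair) {e : PairSkeleton m → Fin N ⊕ Fin N → ℝ}
    (he : ∀ a, Differentiable ℝ fun y => e y a) (x v : PairSkeleton m) (i : Fin N ⊕ Fin N) :
    |fderiv ℝ (fun y => skelCtrlGen ω₂ lam β γ N T_L T_R s m κ z r e y i) x v| ≤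
      κ⁻¹ * (∑ k, |fderiv ℝ (fun y => e y k) x v| + (κ⁻¹ * ∑ a, |e x a|) *
        ∑ k, ∑ i', |fderiv ℝ (fun y => skelGramAt ω₂ lam β γ N T_L T_R s m z r y k i') x v|) := by
  have h : fderiv ℝ (fun y => skelCtrlGen ω₂ lam β γ N T_L T_R s m κ z r e y i) x v =
      (regInv (skelGramAt ω₂ lam β γ N T_L T_R s m z r x) κ *ᵥ
        ((fun k => fderiv ℝ (fun y => e y k) x v) -
          (fun k i => fderiv ℝ (fun y => skelGramAt ω₂ lam β γ N T_L T_R s m z r y k i) x v) *ᵥ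
            skelCtrlGen ω₂ lam β γ N T_L T_R s m κ z r e x)) i :=
    congrFun (fderiv_skelCtrlGen_eq hω hl hβ hγ N T_L T_R hs m hκ z r he x v) i
  rw [h]
  refine (abs_regInv_mulVec_apply_le (posSemidef_skelGramAt z r x) hκ _ i).trans
    (mul_le_mul_of_nonneg_left ?_ (inv_nonneg.2 hκ.le))
  rw [Finset.mul_sum, ← Finset.sum_add_distrib]
  refine Finset.sum_le_sum fun k _ => ?_
  rw [Pi.sub_apply]
  refine (abs_sub _ _).trans (add_le_add le_rfl ?_)
  simp only [Matrix.mulVec, dotProduct]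
  refine (Finset.abs_sum_le_sum_abs _ _).trans ?_
  rw [Finset.mul_sum]
  refine Finset.sum_le_sum fun i' _ => ?_
  rw [abs_mul, mul_comm]
  exact mul_le_mul_of_nonneg_right (abs_skelCtrlGen_le N T_L T_R s m hκ z r e x i') (abs_nonneg _)

end Pointwise

end Summit.AtomisticToContinuum.FouriersLaw.Theorems.ExtensiveSnapshotIrreversibility.EnergyWindow

end
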